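import Summits.HodgeConjecture.HodgeConjecture.Theorems.MilnorKExponentialDefs
import Summits.HodgeConjecture.HodgeConjecture.Theorems.MilnorKExponentialSymbolClassesAlgebraicSymbolClassesHodgeType
import Summits.HodgeConjecture.HodgeConjecture.Theorems.MilnorKExponentialSymbolClassesAlgebraicNashSymbolConiveauOne
import Summits.HodgeConjecture.HodgeConjecture.Theorems.MilnorKExponentialSymbolClassesAlgebraicNashSymbolClassesAlgebraicHigh
import Literature.AlgebraicGeometry.HodgeTheory.SupportedHodgeClassesAlgebraic
import Literature.AlgebraicGeometry.HodgeTheory.GysinKernelProofs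
import Literature.AlgebraicGeometry.HodgeTheory.SaitoGrFDeRhamCurveNetHolds
import Literature.AlgebraicGeometry.HodgeTheory.HodgeRiemannPolarizabilityProofs
import Literature.AlgebraicGeometry.Resolution.ProjectiveResolutionProofs
import Literature.AlgebraicGeometry.HodgeTheory.ComplexOrientationFamily
import Literature.AlgebraicGeometry.HodgeTheory.LefschetzOneOneHolds

/-!
# Crux `SymbolClassesAlgebraic` (GK_p): the known range, unconditionally, and the reduction of the crux to the band of the line `NashDescentSketch`

Support file for the crux `SymbolClassesAlgebraic` (stmt-HodgeConjecture-17743, route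
`MilnorKExponential`): on a smooth projective complex `n`-fold every rational symbol class of weight
`p = q + 1` lies in `algebraicClasses X (q + 1)`.

PROVED here (sorry-free, no definitions, no named facts):

* `gkNamed_outside_band` (REGISTERED sub-goal) — **GK holds unconditionally outside the band
  `1 ≤ q`, `q + 3 ≤ n`**: in weight `1` (the rational symbol class is a rational `(1,1)`-class by the
  landed typing stub `stub_symbolClassesHodgeType`, then Lefschetz `(1,1)`,
  `lefschetzOneOne_rational_holds`), for `n ≤ q + 2` (no classes above the dimension, point classes
  in the top degree, curve classes by hard Lefschetz + Lefschetz `(1,1)`: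
  `mem_algebraicClasses_above_dim / _top_degree / _curveClasses`), and for `n ≤ 3` (the Hodge
  conjecture for curves, surfaces and threefolds, `hodgeClasses_algebraic_of_dim_le_three_holds`).
  So the crux's open content is exactly the band `2 ≤ p ≤ n - 2` on `n`-folds with `n ≥ 4`, first
  case `(n, p) = (4, 2)` — now a theorem of the tree rather than a remark of the census.
* `gkNamed_of_bands` — **GK from the three band stubs of the line** `NashDescentSketch`
  (skeleton `Cruxes/SymbolClassesAlgebraic/Lines/NashDescentSketch.lean`, v3): Nash descent in the
  band (A-band), die-off of rational Nash symbol classes of weight `2` on `n`-folds with `n ≥ 4`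
  (W₁-band), algebraicity of rational Nash symbol classes of weight `3 ≤ p ≤ n - 2` (W_alg-band);
  weight `2` goes through coniveau one (`nashSymbolConiveauOne_low_weights_of_weightTwoBand`) and
  Voisin 2013 Lemma 2.1 (`supportedHodgeClass_algebraic_of_facts`, every fact discharged in the tree).
* `symbolClassesAlgebraic_of_bands` (REGISTERED sub-goal) — the same for the route decl (census
  bridge `route_of_gkNamed`): the crux CLOSED MODULO the three band statements.

## References

* [VoisinHodgeI2002] C. Voisin, Hodge Theory and Complex Algebraic Geometry I (2002), Thm. 6.25,
  §7.1.2, Thm. 11.30.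
* [VoisinHodgeII2003] C. Voisin, Hodge Theory and Complex Algebraic Geometry II (2003), §10.2.3.
* [Voisin2013GHCBloch] C. Voisin, The generalized Hodge and Bloch conjectures are equivalent for general complete intersections, Ann. Sci. ÉNS 46 (2013), Lemma 2.1.
-/

noncomputable section

open CategoryTheory AlgebraicGeometry

-- mandated namespace `Summit.HodgeConjecture.HodgeConjecture.…` (single-problem summit) trips dupNamespace
set_option linter.dupNamespace false

namespace Summit.HodgeConjecture.HodgeConjecture.Theorems.MilnorKExponentialNash

open Literature.AlgebraicGeometry Literature.AlgebraicGeometry.HodgeTheory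
  Literature.AlgebraicGeometry.Motives

/-- **GK holds unconditionally outside the band `1 ≤ q`, `q + 3 ≤ n`.** For a rational symbol
class `c` of weight `q + 1` on a smooth projective complex `n`-fold: in weight `1` it is a rational
`(1,1)`-class (`stub_symbolClassesHodgeType`), algebraic by Lefschetz `(1,1)`
(`lefschetzOneOne_rational_holds`); for `n ≤ q + 2` it is `0` above the dimension, a point class in
the top degree, or a curve class (`mem_algebraicClasses_above_dim`, `…_top_degree`,
`…_curveClasses` — hard Lefschetz + Lefschetz `(1,1)` on the rational `(n-1,n-1)`-class); for
`n ≤ 3` it is the Hodge conjecture in dimension `≤ 3` (`hodgeClasses_algebraic_of_dim_le_three_holds`).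
[cite: VoisinHodgeI2002, Thm. 6.25, §7.1.2 and Thm. 11.30] [cite: VoisinHodgeII2003, §10.2.3] -/
theorem gkNamed_outside_band :
    ∀ ⦃n : ℕ⦄ ⦃X : SchemeOver ℂ⦄, IsSmoothProjective n X → ∀ (q : ℕ), (q = 0 ∨ n ≤ q + 2 ∨ n ≤ 3) →
      ∀ (c : complexBetti X (2 * (q + 1))), IsRationalClass c → IsSymbolClass n X q c →
        c ∈ algebraicClasses X (q + 1) := by
  intro n X hX q hband c hc hs
  have hT : IsOfHodgeType n X (2 * (q + 1)) (q + 1) (q + 1) c := stub_symbolClassesHodgeType hX q c hc hs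
  rcases hband with rfl | hle | hle3
  · exact lefschetzOneOne_rational_holds hX c hc hT
  · rcases Nat.lt_or_ge n (q + 1) with hlt | hge
    · exact mem_algebraicClasses_above_dim hX hlt c
    · rcases eq_or_lt_of_le hge with heq | hgt
      · exact mem_algebraicClasses_top_degree hX heq c
      · exact mem_algebraicClasses_curveClasses hX (by omega) c hc hT
  · exact hodgeClasses_algebraic_of_dim_le_three_holds hle3 hX (q + 1) c hc hT

/-- **GK (named) from the three band stubs of the line `NashDescentSketch`.** Outside the band:
`gkNamed_outside_band`. Inside (`1 ≤ q`, `q + 3 ≤ n`): the class is a Nash symbol class by Nash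
descent in the band (`hA`); in weight `2` it dies off a proper Zariski-closed subset (`h2`), hence has
coniveau `≥ 1` (`nashSymbolConiveauOne_low_weights_of_weightTwoBand`) and is algebraic by Voisin 2013
Lemma 2.1 (`supportedHodgeClass_algebraic_of_facts`, all facts discharged) applied to the rational
`(2,2)`-class given by `stub_symbolClassesHodgeType`; in weight `≥ 3` it is algebraic by `h3`.
[cite: Voisin2013GHCBloch, Lemma 2.1] -/
theorem gkNamed_of_bands
    (hA : ∀ ⦃n : ℕ⦄ ⦃X : SchemeOver ℂ⦄, IsSmoothProjective n X → ∀ (q : ℕ), 1 ≤ q → q + 3 ≤ n →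
      ∀ (c : complexBetti X (2 * (q + 1))), IsRationalClass c → IsSymbolClass n X q c →
        IsNashSymbolClass n X q c)
    (h2 : ∀ ⦃n : ℕ⦄ ⦃X : SchemeOver ℂ⦄, IsSmoothProjective n X → 4 ≤ n →
      ∀ (c : complexBetti X (2 * (1 + 1))), IsRationalClass c → IsNashSymbolClass n X 1 c →
        ∃ Z : Set X.left, IsClosed Z ∧ Z ≠ Set.univ ∧
          complexBetti.restrictCompl X Z (2 * (1 + 1)) c = 0)
    (h3 : ∀ ⦃n : ℕ⦄ ⦃X : SchemeOver ℂ⦄, IsSmoothProjective n X → ∀ (q : ℕ), 2 ≤ q → q + 3 ≤ n →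
      ∀ (c : complexBetti X (2 * (q + 1))), IsRationalClass c → IsNashSymbolClass n X q c →
        c ∈ algebraicClasses X (q + 1)) :
    GKNamed := by
  intro n X hX q c hc hs
  by_cases hband : q = 0 ∨ n ≤ q + 2 ∨ n ≤ 3
  · exact gkNamed_outside_band hX q hband c hc hs
  · simp only [not_or, not_le] at hband
    obtain ⟨hq0, hqn, hn3⟩ := hband
    have hN : IsNashSymbolClass n X q c := hA hX q (by omega) (by omega) c hc hs
    rcases q with _ | _ | q
    · exact absurd rfl hq0
    · have h1 : c ∈ supportedClasses X (2 * (1 + 1)) 1 :=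
        nashSymbolConiveauOne_low_weights_of_weightTwoBand h2 hX 1 le_rfl c hc hN
      exact supportedHodgeClass_algebraic_of_facts
        Deligne1974_ker_restrictCompl_eq_iSup_range_complexGysin_holds
        Voisin2025_hodgeClass_lift_complexGysin_holds
        (Literature.AlgebraicTopology.SingularHomology.gysinMap_restrictCompl_eq_zero_of_field ℂ)
        Resolution.Hironaka1964_projective_holds lefschetzOneOne_rational_holds complexOrientationFamily
        (OrientationFamily.hasPoincareDuality _) hX 1 c h1 hc
        (stub_symbolClassesHodgeType hX 1 c hc hs)
    · exact h3 hX (q + 2) (by omega) (by omega) c hc hN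

/-- **The crux closed modulo the three band statements of the line `NashDescentSketch`**: Nash
descent in the band, die-off of weight-`2` rational Nash symbol classes on `n`-folds with `n ≥ 4`,
and algebraicity of rational Nash symbol classes of weight `3 ≤ p ≤ n - 2` together imply the route
decl `SymbolClassesAlgebraic` (via `gkNamed_of_bands` and the bridge `route_of_gkNamed`).
[cite: Voisin2013GHCBloch, Lemma 2.1] -/
theorem symbolClassesAlgebraic_of_bands :
    (∀ ⦃n : ℕ⦄ ⦃X : SchemeOver ℂ⦄, IsSmoothProjective n X → ∀ (q : ℕ), 1 ≤ q → q + 3 ≤ n →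
      ∀ (c : complexBetti X (2 * (q + 1))), IsRationalClass c → IsSymbolClass n X q c →
        IsNashSymbolClass n X q c) →
    (∀ ⦃n : ℕ⦄ ⦃X : SchemeOver ℂ⦄, IsSmoothProjective n X → 4 ≤ n →
      ∀ (c : complexBetti X (2 * (1 + 1))), IsRationalClass c → IsNashSymbolClass n X 1 c →
        ∃ Z : Set X.left, IsClosed Z ∧ Z ≠ Set.univ ∧
          complexBetti.restrictCompl X Z (2 * (1 + 1)) c = 0) →
    (∀ ⦃n : ℕ⦄ ⦃X : SchemeOver ℂ⦄, IsSmoothProjective n X → ∀ (q : ℕ), 2 ≤ q → q + 3 ≤ n →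
      ∀ (c : complexBetti X (2 * (q + 1))), IsRationalClass c → IsNashSymbolClass n X q c →
        c ∈ algebraicClasses X (q + 1)) →
    Theses.MilnorKExponential.SymbolClassesAlgebraic :=
  fun hA h2 h3 ↦ route_of_gkNamed (gkNamed_of_bands hA h2 h3)

end Summit.HodgeConjecture.HodgeConjecture.Theorems.MilnorKExponentialNash

end
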